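import Summits.ValiantsHypothesis.ValiantsHypothesis.Theorems.KPlusLogSqLawLiftingRungFourRangeGRW
import Summits.ValiantsHypothesis.ValiantsHypothesis.Theorems.KPlusLogSqLawTropicalGradedWalkChainThree
import Summits.ValiantsHypothesis.ValiantsHypothesis.Theorems.LacunarySymmetroidMatrixDescartesDegreeCeiling

/-!
# Route «KPlusLogSqLaw», crux `Lifting` / `WeakLifting` — the `K = 4` LIFT rung holds for EVERY size `m`
# on all supports of height `≤ 8192·m`; a counterexample to the rung is a large LACUNARY pencil

HONEST FRAMING.  Helper (location bookkeeping, no stub credit) toward the lifting cruxes of route `KPlusLogSqLaw`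
(`Summit.ValiantsHypothesis.ValiantsHypothesis.Theses.KPlusLogSqLaw.Lifting`, item `stmt-ValiantsHypothesis-19772`, which implies
`…KPlusLogSqLaw.WeakLifting`, item `stmt-ValiantsHypothesis-19561`); cell `pub-symmetroid`, seat val-sym-lift-p3 g24, 2026-08-29.
The `K = 4` rung of the registered skeleton `Cruxes/Lifting/Lines/birth.lean` asks, for every size `m` and every `n` with
`TropRootLawAt m 4 n`, the real row `RealRootLawAt m 4 (2^(3·4)·(n+1))`.  The tree has it on ALL supports for `m ≤ 18000`
(`lift_rung_four_of_le_grw`, this lineage g20) and for `m ≤ 24569` (`lift_rung_four_of_le_grw3`, g22: Descartes `2·C(m+3,3) − 1`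
against the kernel tropical floor `2m² ≤ n` of `TropicalCensus.grw3_le_of_tropRootLawAt_four`), and beyond that size the rung is the
cell's open `K = 4` fork (D2: a cubic tropical `(m,4)` family or a sub-Descartes real bound).  This file adds the DEGREE side of the same bookkeeping: the tree's degree ceiling
`card_roots_det_pencil_le_degree` (`≤ m·D` distinct real zeros when all exponents are `≤ D`) fits under `4096·(2m² + 1)` whenever
`D ≤ 8192·m`.  Hence:

* `lift_rung_four_on_height` — for EVERY `m`, every `n` with `TropRootLawAt m 4 n`, and every real symmetric `4`-term pencil of size
  `m` whose exponents are all `≤ 8192·m`, the determinant has at most `2^(3·4)·(n+1)` distinct real zeros (sizes `m ≤ 18000`: the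
  tree's rung `lift_rung_four_of_le_grw`, all supports; sizes `m ≥ 18001`: degree ceiling + GRW floor);
* `rung_four_counterexample_located` — contrapositive: a pencil violating the `K = 4` rung inequality has size `m ≥ 18001` AND some
  exponent `> 8192·m` (so `> 1.4·10⁸`): the fork lives on genuinely LACUNARY supports of large size, out of reach of any census
  (with `lift_rung_four_of_le_grw3` the size bound reads `m ≥ 24570`).

WHAT THIS IS NOT: it does not touch the fork itself (`TropicalCensus.TropK4Law 2` vs a cubic family; the typed fork is
`TropicalCensus.not_lifting_of_tropK4Law_of_realGrowth`), and asserts nothing about `Lifting`, `WeakLifting`, `TropicalB`, `KPlusLogSqLaw`,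
`MatrixDescartes` (stmt-ValiantsHypothesis-18050) or `VP ≠ VNP`.  Def-free. [folklore] degree count + arithmetic.
-/

set_option linter.dupNamespace false
set_option autoImplicit false

namespace Summit.ValiantsHypothesis.ValiantsHypothesis.Theorems.KPlusLogSqLaw

open Summit.ValiantsHypothesis.ValiantsHypothesis.Theorems.LacunarySymmetroidMatrixDescartes (RealRootLawAt
  card_roots_det_pencil_le_degree)
open Summit.ValiantsHypothesis.ValiantsHypothesis.Theorems.LacunarySymmetroidMatrixDescartes.TropicalCensus (TropRootLawAt
  grw3_le_of_tropRootLawAt_four)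

/-- the arithmetic of the height zone: `m·D ≤ 4096·(n+1)` once `D ≤ 8192·m` and `2m² ≤ n`. [folklore] -/
theorem height_zone_arith (m n D : ℕ) (hD : D ≤ 8192 * m) (hn : 2 * m ^ 2 ≤ n) :
    m * D ≤ 2 ^ (3 * 4) * (n + 1) := by
  have h1 : m * D ≤ m * (8192 * m) := Nat.mul_le_mul_left _ hD
  have h2 : m * (8192 * m) = 4096 * (2 * m ^ 2) := by ring
  rw [show 2 ^ (3 * 4) = 4096 by norm_num]
  calc m * D ≤ 4096 * (2 * m ^ 2) := h2 ▸ h1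
    _ ≤ 4096 * (n + 1) := Nat.mul_le_mul_left _ (by omega)

/-- **The `K = 4` LIFT rung on the height zone, EVERY size `m`:** for a real symmetric `4`-term lacunary pencil of size `m` whose
exponents are all `≤ D ≤ 8192·m`, the tropical row bound `TropRootLawAt m 4 n` controls the real zero count by `2^(3·4)·(n+1)`.
Sizes `m ≤ 18000`: the tree's rung `lift_rung_four_of_le_grw` (all supports); sizes `m ≥ 18001`: degree ceiling
`card_roots_det_pencil_le_degree` (`≤ m·D`) and the GRW floor `2m² ≤ n`. [folklore] -/
theorem lift_rung_four_on_height (m n D : ℕ) (d : Fin 4 → ℕ) (S : Fin 4 → Matrix (Fin m) (Fin m) ℝ)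
    (hS : ∀ l, (S l).IsSymm) (hd : ∀ l, d l ≤ D) (hD : D ≤ 8192 * m) (h : TropRootLawAt m 4 n) :
    (Matrix.det (∑ l, ((Polynomial.X : Polynomial ℝ) ^ d l) • (S l).map Polynomial.C)).roots.toFinset.card
      ≤ 2 ^ (3 * 4) * (n + 1) := by
  by_cases hm : m ≤ 18000
  · exact lift_rung_four_of_le_grw m n hm h d S hS
  · have hfloor := grw3_le_of_tropRootLawAt_four m n (by omega) h
    exact (card_roots_det_pencil_le_degree d S D hd).trans (height_zone_arith m n D hD hfloor)

/-- **Location of any counterexample to the `K = 4` rung:** if a real symmetric `4`-term pencil of size `m` has more than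
`2^(3·4)·(n+1)` distinct real zeros while `TropRootLawAt m 4 n` holds, then `m ≥ 18001` and some exponent exceeds `8192·m`
(hence exceeds `1.4·10⁸`). [folklore] -/
theorem rung_four_counterexample_located (m n : ℕ) (d : Fin 4 → ℕ) (S : Fin 4 → Matrix (Fin m) (Fin m) ℝ)
    (hS : ∀ l, (S l).IsSymm) (h : TropRootLawAt m 4 n)
    (hbig : 2 ^ (3 * 4) * (n + 1) <
      (Matrix.det (∑ l, ((Polynomial.X : Polynomial ℝ) ^ d l) • (S l).map Polynomial.C)).roots.toFinset.card) :
    18001 ≤ m ∧ ∃ l, 8192 * m < d l := by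
  refine ⟨?_, ?_⟩
  · by_contra hm
    exact absurd (lift_rung_four_of_le_grw m n (by omega) h d S hS) (not_le.mpr hbig)
  · by_contra hno
    push Not at hno
    exact absurd (lift_rung_four_on_height m n (8192 * m) d S hS hno le_rfl h) (not_le.mpr hbig)

end Summit.ValiantsHypothesis.ValiantsHypothesis.Theorems.KPlusLogSqLaw
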